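import Literature.AlgebraicGeometry.HodgeTheory.ZariskiProjectiveBundleHodgeConjecture
import Literature.AlgebraicGeometry.HodgeTheory.DivisorCupRaisesGeometricConiveau
import Literature.AlgebraicGeometry.HodgeTheory.SupportedHodgeClassesAlgebraic
import Literature.AlgebraicGeometry.HodgeTheory.HodgeConjectureQbarVoisinProofs
import Literature.AlgebraicGeometry.HodgeTheory.GysinKernelProofs
import Literature.AlgebraicGeometry.HodgeTheory.GlobalInvariantCyclesProofs
import Literature.AlgebraicGeometry.HodgeTheory.ChernCharacterBetti
import Literature.AlgebraicTopology.SingularHomology.UniversalCoefficientsField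
import HarnessLib

/-!
# A section of a Zariski-locally trivial `ℙʳ`-bundle pulls algebraic classes back to algebraic classes
# (Fulton 1998, Thm. 3.3 (b) "Gysin for bundles"; Voisin I, Lemma 7.32 — on the coniveau carrier)

Topic `Literature/AlgebraicGeometry/HodgeTheory`. THEOREMS ONLY (no definition, no named fact), over
the tree's carriers `complexBetti`, `supportedClasses X k c = Nᶜ Hᵏ(X(ℂ); ℂ)`,
`algebraicClasses X p = Nᵖ H²ᵖ(X(ℂ); ℂ)`, `complexGysin`, and the Literature predicate
`Resolution.IsZariskiProjectiveBundle r q` (Zariski-locally over `X`, `q : E ⟶ X` is isomorphic over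
`X` to `U ⊗ ℙʳ_ℂ → U`).

Let `q : E ⟶ X` be a Zariski `ℙʳ`-bundle of smooth projective complex varieties (`dim X = n`,
`dim E = n + r`) and `s : X ⟶ E` a section (`s ≫ q = 𝟙`). Then (`map_section_mem_algebraicClasses`)

  `s^*(Nᵖ H²ᵖ(E(ℂ); ℂ)) ⊆ Nᵖ H²ᵖ(X(ℂ); ℂ)`  for every `p`.

Printed proof (W. Fulton, *Intersection Theory*, Thm. 3.3 (b) and §3.3; C. Voisin, *Hodge Theory I*,
Lemma 7.32): the projective bundle formula — every `y ∈ H²ᵖ(E)` is `Σ_{b ≤ min r p} ζᵇ ∪ q^* x_b` for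
the hyperplane class `ζ` of a projective embedding of `E` (Leray–Hirsch, the tree's
`ZariskiProjectiveBundle.exists_expansion`), the coefficients `x_b` are extracted by the Gysin
push-forward `q_*` from the top power down (`q_*(ζʳ) = λ · 1` with `λ ≠ 0`), and
`s^* y = Σ_b (s^* ζ)ᵇ ∪ x_b` because `s^* q^* = 𝟙`. Run on the support carriers:

* `map_mem_supportedClasses_of_isZariskiProjectiveBundle` — `q^*(Nᶜ Hᵏ(X)) ⊆ Nᶜ Hᵏ(E)`: `q` is smooth
  (`IsZariskiProjectiveBundle.smoothOfRelativeDimension`), hence flat, and flat pull-back respects the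
  support filtration (`map_mem_supportedClasses_of_flat`; Grothendieck 1969 §1, Hartshorne III 9.2/9.5);
* `eq_zero_of_forall_cupProduct_eq_zero` — the cup product pairing of a smooth projective variety is
  non-degenerate (Poincaré duality + universal coefficients over a field);
* `complexGysin_cupProduct_map_eq_zero_of_lt` — `q_*(q^* x ∪ z) = 0` for `deg z < 2r`;
* `lerayHirschCoeff_mem_algebraicClasses` — **the coefficients of an algebraic class are algebraic**:
  if `Σ_{b < B} q^* x_b ∪ ζᵇ ∈ Nᵖ H²ᵖ(E)` then every `x_b ∈ Nᵖ⁻ᵇ H²ᵖ⁻²ᵇ(X)` (top-down extraction;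
  the correction terms `q_*(q^* x_b ∪ ζ^{r+b-a})` are algebraic by flat pull-back, divisor cups
  `cupProduct_cupPowTwo_mem_algebraicClasses` and the coniveau shift of Gysin maps
  `complexGysin_mem_supportedClasses`);
* `exists_complexGysin_cupPow_eq` — **`q_*(ζʳ) = c • 1_X` with `c ≠ 0`** for a class `ζ ∈ H²(E)`
  restricting non-trivially to the fibres: if `c = 0`, the projection formula and the top-degree
  Leray–Hirsch expansion force `q_* = 0 : H^{2n+2r}(E) → H^{2n}(X) ≠ 0`, whereas `q_*` is onto there
  (`q^*` is one-to-one on `H⁰`, so `q(ℂ)_*` is onto on `H₀`, and `q_*` is `q(ℂ)_*` read through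
  Poincaré duality);
* `map_section_mem_algebraicClasses` — the section pull-back theorem.

Provenance: this is the Literature home of the Summits-side files
`Summits/HodgeConjecture/HodgeConjecture/Theorems/BoundaryReadoutPullbackAlgebraic{BundlePullback,
BundleLerayHirsch (§(i)), SectionReadout, LerayHirschReadout, SectionPullback}.lean` (route
`BoundaryReadout`, crux `PullbackAlgebraic`, stmt-HodgeConjecture-1071; prover seats of that route),
restated on `Resolution.IsZariskiProjectiveBundle` and on the Literature twins already landed by the
cell `pub/hodge-nonav` (`ZariskiProjectiveBundleLerayHirsch`: `bijective_lhMap`, `exists_expansion`;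
`ZariskiProjectiveBundleHodgeConjecture`: `exists_isRationalClass_lhClass`, `cupPow_eq_cupPowTwo`,
`cupProduct_cupPowTwo_mem_algebraicClasses`; `AlgebraicClassesCupDivisorHolds`:
`cupProduct_mem_algebraicClasses_one_right`; `DivisorCupRaisesGeometricConiveau`:
`map_mem_algebraicClasses_one`), so that the deformation to the normal cone
(`DeformationToNormalConeConstantLift`, `DeformationToNormalConeDatum`) and the discharge of the named
fact `fulton1998_map_mem_algebraicClasses` (`AlgebraicClassesPullbackHolds`) can live in `Literature/`.

## References

* [Fulton1998] W. Fulton, Intersection Theory, 2nd ed. (1998), Thm. 3.3 (b), Prop. 3.1 (a), §3.3,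
  Ex. 19.2.1.
* [VoisinHodgeI2002] C. Voisin, Hodge Theory and Complex Algebraic Geometry I (2002), §7.3.2
  Lemma 7.28, §7.3.3 Lemma 7.32.
* [FultonYoungTableaux1997] W. Fulton, Young Tableaux (1997), App. B §B.1 (3), (5), (6).
* [HatcherAT2002] A. Hatcher, Algebraic Topology (2002), §3.2 Prop. 3.10 and Thm. 3.11, §3.3
  Thm. 3.30, p. 241, §4.D Thm. 4D.1.
* [GrothendieckTopology1969] A. Grothendieck, Hodge's general conjecture is false for trivial reasons,
  Topology 8 (1969), §1.
* [Hartshorne1977] R. Hartshorne, Algebraic Geometry (1977), III Prop. 9.2 (b),(c), Prop. 9.5,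
  Prop. 10.1.
-/

noncomputable section

open CategoryTheory AlgebraicGeometry MonoidalCategory CartesianMonoidalCategory
  Literature.AlgebraicGeometry Literature.AlgebraicGeometry.Motives
  Literature.AlgebraicGeometry.Resolution
open Literature.AlgebraicTopology.SingularHomology
open Literature.AlgebraicTopology.CharacteristicClasses (cupPow cupPow_zero cupPow_succ map_cupPow)

namespace Literature.AlgebraicGeometry.HodgeTheory

namespace ZariskiProjectiveBundle

variable {n r : ℕ} {X E : SchemeOver ℂ}

/-! ### Flat pull-back along the bundle projection -/

/-- **Pull-back along a Zariski-locally trivial `ℙʳ`-bundle of smooth projective varieties preserves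
the support filtration: `q^*(Nᶜ Hᵏ(X(ℂ); ℂ)) ⊆ Nᶜ Hᵏ(E(ℂ); ℂ)`.** Such a `q` is smooth of relative
dimension `r` (`IsZariskiProjectiveBundle.smoothOfRelativeDimension`), hence flat; both schemes are
locally Noetherian; and flat pull-back respects the support filtration
(`map_mem_supportedClasses_of_flat`: codimension does not drop along a flat morphism).
[cite: GrothendieckTopology1969, §1] [cite: Hartshorne1977, III Prop. 9.2 (b),(c), Prop. 9.5 and Prop. 10.1] -/
theorem map_mem_supportedClasses_of_isZariskiProjectiveBundle (q : E ⟶ X)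
    (hX : IsSmoothProjective n X) (hE : IsSmoothProjective (n + r) E)
    (htriv : IsZariskiProjectiveBundle r q) {k c : ℕ} {x : complexBetti X k}
    (hx : x ∈ supportedClasses X k c) : complexBetti.map q k x ∈ supportedClasses E k c := by
  haveI : SmoothOfRelativeDimension r q.left := htriv.smoothOfRelativeDimension
  haveI : Smooth q.left := SmoothOfRelativeDimension.smooth r q.left
  haveI : IsLocallyNoetherian E.left := IsSmoothProjective.isLocallyNoetherian_holds hE
  haveI : IsLocallyNoetherian X.left := IsSmoothProjective.isLocallyNoetherian_holds hX
  exact map_mem_supportedClasses_of_flat q hx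

/-- In particular `q^*(Nᶜ H²ᶜ(X)) ⊆ Nᶜ H²ᶜ(E)` for the algebraic classes.
[cite: GrothendieckTopology1969, §1] [cite: Hartshorne1977, III Prop. 9.5 and Prop. 10.1] -/
theorem map_mem_algebraicClasses_of_isZariskiProjectiveBundle (q : E ⟶ X)
    (hX : IsSmoothProjective n X) (hE : IsSmoothProjective (n + r) E)
    (htriv : IsZariskiProjectiveBundle r q) {c : ℕ} {x : complexBetti X (2 * c)}
    (hx : x ∈ algebraicClasses X c) : complexBetti.map q (2 * c) x ∈ algebraicClasses E c :=
  map_mem_supportedClasses_of_isZariskiProjectiveBundle q hX hE htriv hx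

/-! ### Non-degeneracy of the cup product pairing and the degree vanishing of `q_*` -/

/-- **The cup product pairing of a smooth projective variety is non-degenerate**: if
`v ∪ u = 0` for every class `v` of complementary degree, then `u = 0` (`⟨u, v ⌢ [X]⟩ = ⟨v ∪ u, [X]⟩`,
Poincaré duality `v ↦ v ⌢ [X]` is onto, and the Kronecker map is one-to-one over a field).
[cite: HatcherAT2002, §3.3 Thm. 3.30 and p. 241] -/
theorem eq_zero_of_forall_cupProduct_eq_zero (μ : OrientationFamily) (hX : IsSmoothProjective n X)
    {b b' : ℕ} (h : b' + b = 2 * n) {u : complexBetti X b}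
    (hu : ∀ v : complexBetti X b', cupProduct h v u = 0) : u = 0 := by
  have hμ := OrientationFamily.hasPoincareDuality μ hX
  apply kroneckerPairing_injective_of_field ℂ (ComplexPoints X) b
  rw [map_zero]
  refine LinearMap.ext fun z ↦ ?_
  obtain ⟨v, rfl⟩ := (hμ h).2 z
  rw [LinearMap.zero_apply, poincareDualityMap_apply, ← kroneckerPairing_cupProduct, hu v, map_zero,
    LinearMap.zero_apply]

/-- **Degree vanishing of the extraction**: for `q : E ⟶ X` between smooth projective varieties of
dimensions `n + r` and `n`, `x ∈ Hᶜ(X(ℂ))` and `z ∈ H²ᵏ(E(ℂ))` with `k < r`, `q_*(q^* x ∪ z) = 0`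
(in print: `q_*(q^* x ∪ z) = x ∪ q_* z` and `q_* z` has negative degree; here: for every `v` of
complementary degree `v ∪ q_*(q^* x ∪ z) = q_*(q^*(v ∪ x) ∪ z)` by the projection formula, and
`v ∪ x` lies above the top degree of `X`). [cite: FultonYoungTableaux1997, Appendix B §B.1 (6)]
[cite: HatcherAT2002, §3.3 Thm. 3.30] -/
theorem complexGysin_cupProduct_map_eq_zero_of_lt (μ : OrientationFamily) (hX : IsSmoothProjective n X)
    (hE : IsSmoothProjective (n + r) E) (q : E ⟶ X) {c k a b : ℕ} (hk : k < r)
    (hca : c + 2 * k = a) (hab : a + 2 * n = b + 2 * (n + r)) (x : complexBetti X c)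
    (z : complexBetti E (2 * k)) :
    complexGysin μ hE hX q hab (cupProduct hca (complexBetti.map q c x) z) = 0 := by
  have hμ := OrientationFamily.hasPoincareDuality μ
  by_cases hb : 2 * n < b
  · haveI := subsingleton_complexBetti hX hb
    exact Subsingleton.elim _ _
  · refine eq_zero_of_forall_cupProduct_eq_zero μ hX (b' := 2 * n - b) (by omega) fun v ↦ ?_
    rw [← complexGysin_cup hμ hE hX q (rfl : (2 * n - b) + a = (2 * n - b) + a) (by omega) hab
      (by omega) v, ← cupProduct_assoc (rfl : (2 * n - b) + c = (2 * n - b) + c) hca (by omega)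
      rfl, ← cupProduct_map]
    haveI := subsingleton_complexBetti hX (k := 2 * n - b + c) (by omega)
    rw [Subsingleton.elim (cupProduct rfl v x) 0, map_zero, map_zero, LinearMap.zero_apply, map_zero]

/-! ### The coefficients of an algebraic class in a divisor-power expansion are algebraic -/

/-- `xⁱ ∪ xʲ = xⁱ⁺ʲ` for the cup powers `cupPowTwo` of a degree-`2` class.
[cite: HatcherAT2002, §3.2 p. 211] -/
theorem cupProduct_cupPowTwo_cupPowTwo {Y : Type} [TopologicalSpace Y]
    (x : singularCohomology ℂ ℂ Y 2) (i j : ℕ) (h : 2 * i + 2 * j = 2 * (i + j)) :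
    cupProduct h (cupPowTwo x i) (cupPowTwo x j) = cupPowTwo x (i + j) := by
  induction j with
  | zero => exact cupProduct_one' ℂ _ _
  | succ j ih =>
    rw [cupPowTwo_succ, ← cupProduct_assoc (show 2 * i + 2 * j = 2 * (i + j) by ring)
      (two_mul_add_two j) (show 2 * (i + j) + 2 = 2 * (i + (j + 1)) by ring) h, ih (by ring)]
    rfl

/-- Degree bookkeeping for the expansions `Σ_{b < B} q^* x_b ∪ ζᵇ` in degree `2p`, `B ≤ p + 1`
(the degrees in Fulton's Thm. 3.3 (b)). [cite: Fulton1998, Thm. 3.3 (b)] -/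
theorem two_mul_sub_add (p : ℕ) {B : ℕ} (hBp : B ≤ p + 1) (b : Fin B) :
    2 * (p - b) + 2 * (b : ℕ) = 2 * p := by
  have := b.2; omega

/-- **The coefficients of an algebraic class are algebraic** (the Gysin extraction of the
projective bundle formula, run on the support carriers; Fulton Thm. 3.3 (b), Voisin I Lemma 7.32).
Let `q : E ⟶ X` be a morphism of smooth projective complex varieties of dimensions `n + r`, `n`;
`ζ ∈ N¹ H²(E)` a divisor class with `q_*(ζʳ) = λ · 1`, `λ ≠ 0`; and suppose `q^*` preserves algebraic
classes. If `Σ_{b < B} q^* x_b ∪ ζᵇ ∈ Nᵖ H²ᵖ(E)` (`B ≤ p + 1`, `B ≤ r + 1`), then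
`x_b ∈ Nᵖ⁻ᵇ H²ᵖ⁻²ᵇ(X)` for every `b`. Proof, top down in `a`: apply `q_*(· ∪ ζ^{r-a})`; the terms
`b < a` vanish (`complexGysin_cupProduct_map_eq_zero_of_lt`), the term `b = a` is
`x_a ∪ q_*(ζʳ) = λ x_a` (projection formula), the terms `b > a` are `q_*(q^* x_b ∪ ζ^{r+b-a})`,
algebraic by induction, divisor cups and the coniveau shift of `q_*`.
[cite: Fulton1998, Thm. 3.3 (b) and §3.3] [cite: VoisinHodgeI2002, Lemma 7.32]
[cite: FultonYoungTableaux1997, Appendix B §B.1 (6)] -/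
theorem lerayHirschCoeff_mem_algebraicClasses (μ : OrientationFamily) (hX : IsSmoothProjective n X)
    (hE : IsSmoothProjective (n + r) E) (q : E ⟶ X) {ζ : complexBetti E 2}
    (hζ : ζ ∈ algebraicClasses E 1)
    (hconiv : ∀ (c : ℕ), ∀ x ∈ algebraicClasses X c, complexBetti.map q (2 * c) x ∈ algebraicClasses E c)
    {lam : ℂ} (hlam0 : lam ≠ 0)
    (hlam : complexGysin μ hE hX q (show 2 * r + 2 * n = 0 + 2 * (n + r) by ring) (cupPowTwo ζ r) =
      lam • singularCohomology.one ℂ _)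
    {p B : ℕ} (hBp : B ≤ p + 1) (hBr : B ≤ r + 1) (x : (b : Fin B) → complexBetti X (2 * (p - b)))
    (hy : (∑ b : Fin B, cupProduct (two_mul_sub_add p hBp b)
      (complexBetti.map q (2 * (p - b)) (x b)) (cupPowTwo ζ b)) ∈ algebraicClasses E p) :
    ∀ b : Fin B, x b ∈ algebraicClasses X (p - b) := by
  have hμ := OrientationFamily.hasPoincareDuality μ
  have hS := gysinMap_restrictCompl_eq_zero_of_field ℂ
  -- strong downward induction on the index
  suffices H : ∀ (e : ℕ) (a : Fin B), B ≤ a + e → x a ∈ algebraicClasses X (p - a) from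
    fun b ↦ H B b (by omega)
  intro e
  induction e with
  | zero => intro a ha; exact absurd a.2 (by omega)
  | succ e ih =>
    intro a ha
    -- write `r = a + j`
    obtain ⟨j, rfl⟩ : ∃ j, r = a + j := ⟨r - a, by have := a.2; omega⟩
    have hap : (a : ℕ) ≤ p := by have := a.2; omega
    -- the class `Y = y ∪ ζʲ ∈ N^{p+j}` and its push-forward `G = q_* Y ∈ N^{p-a}`
    set y := ∑ b : Fin B, cupProduct (two_mul_sub_add p hBp b)
      (complexBetti.map q (2 * (p - b)) (x b)) (cupPowTwo ζ b) with hy_def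
    have hY : cupProduct (show 2 * p + 2 * j = 2 * (p + j) by ring) y (cupPowTwo ζ j) ∈
        algebraicClasses E (p + j) :=
      cupProduct_cupPowTwo_mem_algebraicClasses hE hζ hy j rfl (by ring)
    have habG : 2 * (p + j) + 2 * n = 2 * (p - a) + 2 * (n + (a + j)) := by omega
    have hG : complexGysin μ hE hX q habG (cupProduct (show 2 * p + 2 * j = 2 * (p + j) by ring) y
        (cupPowTwo ζ j)) ∈ algebraicClasses X (p - a) :=
      complexGysin_mem_supportedClasses hS μ hμ hE hX q habG
        (r := p + j) (s := p - a) (by omega) hY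
    -- the terms `T b = q_*(q^* x_b ∪ ζ^{b+j})`
    have hdeg : ∀ b : Fin B, 2 * (p - b) + 2 * ((b : ℕ) + j) = 2 * (p + j) := by
      intro b; have := b.2; omega
    set T : Fin B → complexBetti X (2 * (p - a)) := fun b ↦ complexGysin μ hE hX q habG
      (cupProduct (hdeg b) (complexBetti.map q (2 * (p - b)) (x b)) (cupPowTwo ζ (b + j))) with hT_def
    -- `G = Σ_b T b`
    have hGT : complexGysin μ hE hX q habG (cupProduct (show 2 * p + 2 * j = 2 * (p + j) by ring) y
        (cupPowTwo ζ j)) = ∑ b : Fin B, T b := by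
      rw [hy_def, map_sum, LinearMap.sum_apply, map_sum]
      refine Finset.sum_congr rfl fun b _ ↦ ?_
      rw [hT_def, cupProduct_assoc (two_mul_sub_add p hBp b) (show 2 * (b : ℕ) + 2 * j = 2 * (b + j) by ring)
        (show 2 * p + 2 * j = 2 * (p + j) by ring) (hdeg b),
        cupProduct_cupPowTwo_cupPowTwo]
    -- `T b = 0` for `b < a`
    have hlt : ∀ b : Fin B, (b : ℕ) < a → T b = 0 := by
      intro b hb
      exact complexGysin_cupProduct_map_eq_zero_of_lt μ hX hE q (k := b + j) (by omega) (hdeg b) habG _ _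
    -- `T a = λ • x a`
    have heq : T a = lam • x a := by
      simp only [hT_def]
      rw [complexGysin_cup hμ hE hX q (hdeg a) habG
        (show 2 * ((a : ℕ) + j) + 2 * n = 0 + 2 * (n + (a + j)) by ring) (Nat.add_zero _) (x a), hlam,
        LinearMap.map_smul, cupProduct_one' ℂ (Nat.add_zero _)]
    -- `T b ∈ N^{p-a}` for `a < b`, by the induction hypothesis
    have hgt : ∀ b : Fin B, (a : ℕ) < b → T b ∈ algebraicClasses X (p - a) := by
      intro b hb
      have hxb : x b ∈ algebraicClasses X (p - b) := ih b (by omega)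
      have h1 : complexBetti.map q (2 * (p - b)) (x b) ∈ algebraicClasses E (p - b) := hconiv _ _ hxb
      have h2 : cupProduct (hdeg b) (complexBetti.map q (2 * (p - b)) (x b)) (cupPowTwo ζ (b + j)) ∈
          algebraicClasses E (p + j) :=
        cupProduct_cupPowTwo_mem_algebraicClasses hE hζ h1 (b + j) (by have := b.2; omega) (hdeg b)
      exact complexGysin_mem_supportedClasses hS μ hμ hE hX q habG
        (r := p + j) (s := p - a) (by omega) h2
    -- assemble: `λ • x a = G - Σ_{b ≠ a} T b`
    have hsplit : ∑ b : Fin B, T b = T a + ∑ b ∈ Finset.univ.erase a, T b :=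
      (Finset.add_sum_erase _ _ (Finset.mem_univ a)).symm
    have hrest : ∑ b ∈ Finset.univ.erase a, T b ∈ algebraicClasses X (p - a) := by
      refine Submodule.sum_mem _ fun b hb ↦ ?_
      rcases lt_or_gt_of_ne (Fin.val_injective.ne (Finset.ne_of_mem_erase hb)) with h | h
      · rw [hlt b h]; exact Submodule.zero_mem _
      · exact hgt b h
    have hlamx : lam • x a ∈ algebraicClasses X (p - a) := by
      have e : lam • x a = ∑ b : Fin B, T b - ∑ b ∈ Finset.univ.erase a, T b := by
        rw [hsplit, heq, add_sub_cancel_right]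
      rw [e, ← hGT]
      exact Submodule.sub_mem _ hG hrest
    have := Submodule.smul_mem _ lam⁻¹ hlamx
    rwa [inv_smul_smul₀ hlam0] at this

/-- **Cup product with powers of a divisor class keeps algebraic classes algebraic**:
`a ∈ Nˡ H²ˡ`, `d ∈ N¹ H²` ⟹ `a ∪ dʲ ∈ Nˡ⁺ʲ H²ˡ⁺²ʲ` (iterate the divisor case of Voisin II Prop. 9.20,
`cupProduct_mem_algebraicClasses_one_right`; cup powers `CharacteristicClasses.cupPow`).
[cite: Fulton1998, §2.3 and Cor. 19.2] [cite: VoisinHodgeII2003, Prop. 9.20] -/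
theorem cupProduct_cupPow_mem_algebraicClasses (hX : IsSmoothProjective n X)
    {d : complexBetti X (2 * 1)} (hd : d ∈ algebraicClasses X 1) {l : ℕ} {a : complexBetti X (2 * l)}
    (ha : a ∈ algebraicClasses X l) :
    ∀ (j m : ℕ) (_ : l + j = m) (h : 2 * l + 2 * j = 2 * m),
      cupProduct h a (cupPow ℂ d j) ∈ algebraicClasses X m
  | 0, m, hm, h => by
    subst hm
    have h1 : cupProduct h a (cupPow ℂ d 0) = a := cupProduct_one a
    rw [h1]
    exact ha
  | j + 1, m, hm, h => by
    subst hm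
    have ih := cupProduct_cupPow_mem_algebraicClasses hX hd ha j (l + j) rfl (by omega)
    rw [cupPow_succ, ← cupProduct_assoc (show 2 * l + 2 * j = 2 * (l + j) by omega)
      (show 2 * j + 2 = 2 * (j + 1) by omega) (show 2 * (l + j) + 2 * 1 = 2 * (l + j + 1) by omega)]
    exact cupProduct_mem_algebraicClasses_one_right hX ih hd

/-! ### The fibre degree of the hyperplane class: `q_*(ζʳ) = c • 1`, `c ≠ 0` -/

section FibreDegree

open Function Set Literature.AlgebraicTopology.SingularHomology.LerayHirsch
  Literature.AlgebraicTopology.CharacteristicClasses Literature.NumberTheory.Transcendental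

/-- **(i) `q_*(ζʳ) = c • 1_X` with `c ≠ 0`**, for a Zariski `ℙʳ`-bundle `q : E ⟶ X` of smooth projective
varieties and a class `ζ ∈ H²(E(ℂ))` restricting non-trivially along every closed immersion `ℙʳ ⟶ E`
(`r ≥ 1`), and the Gysin morphism of any orientation family. `q_*(ζʳ) ∈ H⁰(X(ℂ)) = ℂ · 1` (`X(ℂ)` path
connected). If `c = 0`: every top-degree class of `E(ℂ)` is `q^* a ∪ ζʳ` (Leray–Hirsch
`bijective_lhMap`, `H^{>2n}(X(ℂ)) = 0`), and `q_*(q^* a ∪ ζʳ) = a ∪ q_*(ζʳ) = 0` (projection formula),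
so `q_* = 0` on `H^{2n+2r}(E(ℂ))`; but `q_*` is onto `H^{2n}(X(ℂ)) ≠ 0` there (`q^*` one-to-one on
`H⁰`, hence `q(ℂ)_*` onto on `H₀`, and `q_* = D_X⁻¹ q(ℂ)_* D_E`).
[cite: FultonYoungTableaux1997, Appendix B §B.1 (5)–(6)]
[cite: VoisinHodgeI2002, §7.3.2 Lemma 7.28 and §7.3.3 Lemma 7.32] [cite: HatcherAT2002, §3.3 Thm. 3.30] -/
theorem exists_complexGysin_cupPow_eq (q : E ⟶ X) (hX : IsSmoothProjective n X)
    (hE : IsSmoothProjective (n + r) E) (htriv : IsZariskiProjectiveBundle r q) (ζ : complexBetti E 2)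
    (hζ : 1 ≤ r → ∀ ι : Motives.projectiveSpace r ℂ ⟶ E, IsClosedImmersion ι.left →
      complexBetti.map ι 2 ζ ≠ 0)
    (μ : OrientationFamily) :
    ∃ c : ℂ, c ≠ 0 ∧
      complexGysin μ hE hX q (show 2 * r + 2 * n = 0 + 2 * (n + r) by omega) (cupPow ℂ ζ r) =
        c • singularCohomology.one ℂ (ComplexPoints X) := by
  have hμ := OrientationFamily.hasPoincareDuality μ
  haveI := pathConnectedSpace_complexPoints_of_isSmoothProjective' hX
  have h0 : 2 * r + 2 * n = 0 + 2 * (n + r) := by omega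
  set c : ℂ := singularCohomologyZeroEquiv ℂ ℂ (ComplexPoints X)
    (complexGysin μ hE hX q h0 (cupPow ℂ ζ r)) with hcdef
  have hc : complexGysin μ hE hX q h0 (cupPow ℂ ζ r) = c • singularCohomology.one ℂ (ComplexPoints X) :=
    Literature.AlgebraicGeometry.HodgeTheory.eq_smul_one_of_pathConnectedSpace _
  refine ⟨c, fun hc0 ↦ ?_, hc⟩
  rw [hc0, zero_smul] at hc
  -- the top-degree Gysin morphism vanishes
  have hab : 2 * (n + r) + 2 * n = 2 * n + 2 * (n + r) := by omega
  have hzero : ∀ y, complexGysin μ hE hX q hab y = 0 := by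
    intro y
    obtain ⟨a, rfl⟩ := (bijective_lhMap q hX htriv ζ hζ (2 * (n + r))).2 y
    rw [lhMap_succ, map_add]
    have hrest : lhMap ℂ (evenDeg r) (AlgPoints.mapContinuous (L := ℂ) q)
        (fun i ↦ cupPow ℂ ζ (Fin.castSucc i)) (2 * (n + r)) (restrictSrc ℂ r (2 * (n + r)) a) = 0 := by
      rw [lhMap_apply]
      refine Finset.sum_eq_zero fun i _ ↦ ?_
      split_ifs with h
      · haveI : Subsingleton (complexBetti X (2 * (n + r) - evenDeg r i)) :=
          subsingleton_complexBetti hX (by change 2 * n < 2 * (n + r) - 2 * (i : ℕ); omega)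
        rw [Subsingleton.elim (restrictSrc ℂ r (2 * (n + r)) a ⟨i, h⟩) 0, map_zero,
          LinearMap.map_zero₂]
      · rfl
    have htop : 2 * r ≤ 2 * (n + r) := by omega
    rw [hrest, map_zero, zero_add, dif_pos htop]
    have hpq' : 2 * (n + r) - 2 * r + 0 = 2 * n := by omega
    have key := complexGysin_cup hμ hE hX q (Nat.sub_add_cancel htop) hab h0 hpq'
      (a ⟨Fin.last r, htop⟩) (cupPow ℂ ζ r)
    rw [hc, map_zero] at key
    exact key
  -- but it is onto `H²ⁿ(X(ℂ)) ≠ 0`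
  have hinj : Injective (singularCohomology.map ℂ ℂ (AlgPoints.mapContinuous (L := ℂ) q) 0) :=
    injective_map_of_bijective_lhMap _ ζ 0 (bijective_lhMap q hX htriv ζ hζ 0)
  have hs := surjective_homologyMap_of_injective_cohomologyMap ℂ
    (AlgPoints.mapContinuous (L := ℂ) q) 0 hinj
  have haE : 2 * (n + r) + 0 = 2 * (n + r) := rfl
  have hbX : 2 * n + 0 = 2 * n := rfl
  have hsurj : Surjective (complexGysin μ hE hX q hab) := by
    intro x
    obtain ⟨h', hh'⟩ := hs (capProduct hbX x (μ hX).fundamentalClass)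
    obtain ⟨y, hy⟩ := (hμ hE haE).2 h'
    refine ⟨y, (hμ hX hbX).1 ?_⟩
    rw [poincareDualityMap_apply, poincareDualityMap_apply, capProduct_complexGysin hμ hE hX q hab haE hbX,
      ← hh', ← hy, poincareDualityMap_apply]
  have h1 := finrank_complexBetti_two_mul_eq_one hX
  haveI : Nontrivial (complexBetti X (2 * n)) := Module.nontrivial_of_finrank_eq_succ h1
  obtain ⟨x, hx⟩ := exists_ne (0 : complexBetti X (2 * n))
  obtain ⟨y, rfl⟩ := hsurj x
  exact hx (hzero y)

end FibreDegree

/-! ### The section pull-back -/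

/-- **The section of a Zariski-locally trivial `ℙʳ`-bundle pulls algebraic classes back to algebraic
classes** (Fulton 1998, Thm. 3.3 (b) / Prop. 6.1, "Gysin for bundles"; Voisin I, Lemma 7.32): for
`q : E ⟶ X` between smooth projective complex varieties (`dim X = n`, `dim E = n + r`), Zariski-locally
over `X` isomorphic to `U ⊗ ℙʳ → U`, and `s : X ⟶ E` with `s ≫ q = 𝟙`, `s^*(Nᵖ H²ᵖ(E)) ⊆ Nᵖ H²ᵖ(X)`.
Proof: take the hyperplane class `ζ ∈ N¹ H²(E)` of a projective embedding
(`exists_isRationalClass_lhClass`; it restricts non-trivially to the fibres), expand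
`y = Σ_{b ≤ min r p} ζᵇ ∪ q^* x_b` (`exists_expansion`); the coefficients of the algebraic `y` are
algebraic (`lerayHirschCoeff_mem_algebraicClasses`, fed with the flat pull-back and
`exists_complexGysin_cupPow_eq`); `s^* y = Σ_b (s^* ζ)ᵇ ∪ x_b` (`s^* q^* = 𝟙`), `s^* ζ ∈ N¹ H²(X)`
(`map_mem_algebraicClasses_one`, Lefschetz `(1,1)`), and `x_b ∪ (s^* ζ)ᵇ ∈ Nᵖ`
(`cupProduct_cupPow_mem_algebraicClasses`, graded commutativity in even degrees).
[cite: Fulton1998, Thm. 3.3 (b), Prop. 6.1 and Ex. 19.2.1] [cite: VoisinHodgeI2002, Lemma 7.32 and §7.3.3] -/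
theorem map_section_mem_algebraicClasses (q : E ⟶ X) (s : X ⟶ E) (hX : IsSmoothProjective n X)
    (hE : IsSmoothProjective (n + r) E) (htriv : IsZariskiProjectiveBundle r q) (hsq : s ≫ q = 𝟙 X)
    (p : ℕ) {y : complexBetti E (2 * p)} (hy : y ∈ algebraicClasses E p) :
    complexBetti.map s (2 * p) y ∈ algebraicClasses X p := by
  classical
  -- an orientation family (complex points of smooth projective varieties are orientable)
  let μ : OrientationFamily := fun _ _ h ↦ (Motives.ComplexPoints.isOrientableOver ℂ h).some
  -- the hyperplane class of `E`, its fibre degree, and the Leray–Hirsch expansion of `y`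
  obtain ⟨ζ, -, hζ, hζres⟩ := exists_isRationalClass_lhClass (n := n) (r := r) hE
  obtain ⟨c, hc, hgys⟩ := exists_complexGysin_cupPow_eq q hX hE htriv ζ hζres μ
  obtain ⟨x, hx⟩ := exists_expansion q hX htriv ζ hζres p y
  -- the coefficients of `y` are algebraic: reorder the cup factors and extract top-down
  have hBp : min r p + 1 ≤ p + 1 := by omega
  have e : (∑ b : Fin (min r p + 1),
      cupProduct (show 2 * (b : ℕ) + 2 * (p - (b : ℕ)) = 2 * p by omega)
        (cupPow ℂ ζ b) (complexBetti.map q (2 * (p - (b : ℕ))) (x b))) =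
      ∑ b : Fin (min r p + 1), cupProduct (two_mul_sub_add p hBp b)
        (complexBetti.map q (2 * (p - (b : ℕ))) (x b)) (cupPowTwo ζ b) := by
    refine Finset.sum_congr rfl fun b _ ↦ ?_
    rw [cupProduct_gradedComm_holds ℂ (Motives.ComplexPoints E)
        (show 2 * (b : ℕ) + 2 * (p - (b : ℕ)) = 2 * p by omega) (two_mul_sub_add p hBp b),
      cupPow_eq_cupPowTwo,
      show ((-1 : ℂ) ^ (2 * (b : ℕ) * (2 * (p - (b : ℕ))))) = 1 from
        Even.neg_one_pow ⟨(b : ℕ) * (2 * (p - (b : ℕ))), by ring⟩, one_smul]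
  have hy' := hy
  rw [hx, e] at hy'
  rw [cupPow_eq_cupPowTwo] at hgys
  have hxalg : ∀ b : Fin (min r p + 1), x b ∈ algebraicClasses X (p - (b : ℕ)) :=
    lerayHirschCoeff_mem_algebraicClasses μ hX hE q hζ
      (fun c' x' hx' ↦ map_mem_algebraicClasses_of_isZariskiProjectiveBundle q hX hE htriv hx')
      hc hgys hBp (by omega) x hy'
  -- `s^* q^* = 𝟙`
  have hsq' : ∀ (k : ℕ) (z : complexBetti X k), complexBetti.map s k (complexBetti.map q k z) = z := by
    intro k z
    rw [← CategoryTheory.comp_apply, ← complexBetti.map_comp, hsq, complexBetti.map_id]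
    rfl
  -- `s^* ζ` is a divisor class on `X`
  have hsζ : complexBetti.map s (2 * 1) ζ ∈ algebraicClasses X 1 := map_mem_algebraicClasses_one hE hX s hζ
  -- `s^* y = Σ_b (s^* ζ)ᵇ ∪ x_b`
  rw [hx, map_sum]
  refine Submodule.sum_mem _ fun b _ ↦ ?_
  rw [complexBetti.map, cupProduct_map]
  change cupProduct _ (complexBetti.map s _ (cupPow ℂ ζ b))
    (complexBetti.map s _ (complexBetti.map q _ (x b))) ∈ _
  rw [hsq']
  have hpow : complexBetti.map s (2 * (b : ℕ)) (cupPow ℂ ζ b) =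
      cupPow ℂ (complexBetti.map s (2 * 1) ζ) b :=
    map_cupPow ℂ _ ζ b
  rw [hpow, cupProduct_gradedComm_holds ℂ (Motives.ComplexPoints X) _
    (show 2 * (p - (b : ℕ)) + 2 * (b : ℕ) = 2 * p by omega)]
  refine Submodule.smul_mem _ _ ?_
  exact cupProduct_cupPow_mem_algebraicClasses hX hsζ (hxalg b) b p (by omega) (by omega)

end ZariskiProjectiveBundle

end Literature.AlgebraicGeometry.HodgeTheory

end
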